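import Summits.BirchSwinnertonDyer.BirchSwinnertonDyer.Theorems.SmallImageMuTransferMuTransferX9EulerSystemTameNorm
import Literature.NumberTheory.EllipticCurves.Kato2004.IwasawaH1ReductionTower
import Summits.BirchSwinnertonDyer.BirchSwinnertonDyer.Theorems.SmallImageMuTransferMuTransferX9CoresUnramifiedAt
import HarnessLib

/-!
# K6 crux `MuTransferX9` (stmt-BirchSwinnertonDyer-19276), skeleton v6 stub `stub_stepsTwoFourOdd`,
# input «G3a», file 3: THE GENUINE TAME CLASS — from `Kato2004.IsEulerSystemClass s`, at every tame
# prime `q`, the INTEGRAL class `y = 𝐳̄_q ∈ H¹(Gal(ℚ̄/ℚ(μ_q)), 𝒯_{pⁿ})` whose corestriction to `ℚ` is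
# `P̄_q((1+T)^{κ̄(Fr_q)}) · 𝐳̄₁`, `𝐳̄₁ = (I.redTower s)_{pⁿ}` (the norm relation of MU-TRANSFER-PROOF Lemma 2)

Cell `bsd-smallim`, seat `bsd-smallim-koly` (gen 9).  THEOREMS ONLY (no definition, no named fact, no
`sorry`).  HONEST FRAMING: helper toward the open stub `stub_stepsTwoFourOdd` of skeleton v6
(`a90a661b046bb403`) of the crux `MuTransferX9`; closes nothing.  Third «G3a» file: the assembly
(file 1 `…X9RelativeShapiro` = relative inverse Shapiro + integrality transports; file 2
`…X9EulerSystemTameNorm` = Kato's `cores_cons` at a layer, reduced mod `p`).  The output is EXACTLY the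
input `y` (with `hyI` = Kato integrality and the norm relation behind `h𝒩`) of k6-g3's
`KolyvaginTwist.exists_kolyvaginCocycle_meetingPoint` (p458422) — the one object of the
`stub_stepsTwoFourOdd` assembly that no file in the tree produced (k6-g3 HANDOFF «G3a, no owner»).

## What

* §1 (generic `κ`, `ρ`, layer `n`) `iterate_pushCocycle_unipotent_apply`,
  `coresShapiro_pow_conjMap_eq_oneCocycleClass_iterate` and
  **`exists_cocycle_coresShapiro_aeval_conjMap`** — under the inverse Shapiro map `Sh⁻¹ = coresShapiro n`
  a polynomial `P(conj_g)` (`P ∈ ℤ[X]`) applied to `c ∈ H¹(Γ_n, M)` becomes the class of an EXPLICIT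
  cocycle `ψ` with values `ψ(x) = P((1+S)^a)(φ(x))`, `[φ] = Sh⁻¹ c`, `a ≡ −κ̄_n(g) (mod pⁿ)` (k6-ty's
  `coresShapiro_conjMap` iterated; the polynomial calculus of `H¹`-operators is done ON COCYCLES, so
  that only values in the module `𝒯_{pⁿ}` are compared — no `ℤ`-algebra structure on `H¹` is used).
* §3 **`exists_tameClass_of_isEulerSystemClass`** — for a GENUINE Λ-adic Euler-system class `s`
  (`IsEulerSystemClass W p κ γ I s`): there is a finite `S₀` such that for every place `q ∉ S₀` (with
  prime `ℓ`), every layer `n`, every arithmetic Frobenius `Fr` at `q`, every integer lift `P̄ ∈ ℤ[X]`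
  of the Euler factor `P(Fr⁻¹ | T_pW*; X) mod p` and every `a ≡ κ̄_n(Fr) (mod pⁿ)`, there is
  `y ∈ H¹(N, 𝒯_{pⁿ})`, `N = Gal(ℚ̄/ℚ(μ_ℓ))`, `𝒯_{pⁿ} = κ.twistModP E[p] _ (pⁿ)` (`= W.modPTwist p κ (pⁿ)`
  definitionally), with (i) `y ∈ integralH1` (unramified away from `p` at class level — Kato
  (8.1.3)) and (ii) `cor_N^{Γ_ℚ} y = P̄((1+T)^a) · (I.redTower s)_{pⁿ}` in cocycle form: for every
  cocycle `φ` of `(I.redTower s)_{pⁿ}` a cocycle `ψ` with `ψ(g) = P̄((1+S)^a)(φ(g))` and `cor y = [ψ]`.  Construction: `y := cor_{N∩Γ_n}^{N} ∘ H¹(m ↦ m T⁰) ∘ red ∘ cor_{ℚ(μ_{p^{n+1}},μ_ℓ) → N∩Γ_n}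
  (z_{n+1,{q}})`; proof: file 2 (norm relation at the layer, mod `p`) + file 1 (`cor_N ∘ Sh_N⁻¹ =
  Sh⁻¹ ∘ cor`) + k6-ty's `coresShapiro_conjMap` (`Fr⁻¹ ↦ (1+S)^{κ̄(Fr)}`) and `redTower_apply_coe_pow`.
  NOTHING about the image of `ρ̄` or the splitting of `q` enters: the `E`-split specialisation
  (`P̄ = (1 − X)²`, `(1+S)^a − 1 = S^{p^m}·unit`) and the level-`J` truncation feeding p458422 are the
  next file.

References: K. Kato, Astérisque 295 (2004) (8.1.3), §13.1 (13.1.1), Ex. 13.3, Thm. 12.6, §13.8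
[Kato2004Asterisque]; K. Rubin, *Euler Systems* (2000) Def. 2.1.1, §4.4 [Rubin2000]; J.-P. Serre,
*Galois Cohomology* (1997) I §2.5 [SerreGaloisCohomology1997]; HOME/koly/MU-TRANSFER-PROOF.md §3
(INPUT "`cor_{K/ℚ} 𝐳̄_q = P·𝐳̄_1`" of Lemma 2).
-/

-- the summit and its single problem are both named `BirchSwinnertonDyer` (registry layout D-0017)
set_option linter.dupNamespace false
set_option autoImplicit false

noncomputable section

open CategoryTheory Function Finset Polynomial
open scoped NumberField Pointwise ContRepresentation
open Field IsDedekindDomain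
open Literature.NumberTheory.GaloisRepresentations
open Literature.NumberTheory.EllipticCurves
open Literature.NumberTheory.EllipticCurves.ZpExtension
open Literature.NumberTheory.EllipticCurves.Kato2004
open Literature.NumberTheory.EllipticCurves.Kato2004.EulerSystemValues
open Rat.HeightOneSpectrum
open Summit.BirchSwinnertonDyer.Rank1Residual.GaloisImage

universe u

namespace Summit.BirchSwinnertonDyer.BirchSwinnertonDyer.Rank1Residual.TameClass

/-! ## §1 The inverse Shapiro map and polynomials in `conj_g`, on cocycles -/

section ShapiroPoly

variable {K : Type u} [Field K] {p : ℕ} [Fact p.Prime] (κ : ZpExtension K p)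
variable {M : Type u} [AddCommGroup M] [TopologicalSpace M] [DiscreteTopology M]
variable (ρ : DiscreteGaloisModule K M) (hM : ∀ m : M, p • m = 0) (n : ℕ)
  [Fintype (absoluteGaloisGroup K ⧸ κ.layerSubgroup n)]

omit [Fintype (absoluteGaloisGroup K ⧸ κ.layerSubgroup n)] in
/-- Values of the `k`-fold push of a cocycle along `(1+S)^a`: `((1+S)^a)^k (φ(x))`.
[cite: Washington1997, §13.1–§13.2] -/
theorem iterate_pushCocycle_unipotent_apply (a k : ℕ)
    (φ : contOneCocycles (κ.twistModP ρ hM (p ^ n)).toTopRep) (x : absoluteGaloisGroup K) :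
    ((κ.pushCocycle ρ hM (p ^ n) (κ.twistModPUnipotent ρ hM (p ^ n) a))^[k] φ).1 x =
      (unipotentPow M (p ^ n) a ^ k) (φ.1 x) := by
  induction k with
  | zero => rfl
  | succ k ih =>
    rw [Function.iterate_succ_apply', pushCocycle_apply, twistModPUnipotent_apply, ih, pow_succ',
      Module.End.mul_apply]

/-- Classes of the `k`-fold push: `Sh⁻¹((g·)^k c) = [push^k φ]` when `[φ] = Sh⁻¹ c` — k6-ty's dictionary
`coresShapiro_conjMap` (`conj_g ↦ H¹((1+S)^a)`, `a ≡ −κ̄_n(g)`) iterated.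
[cite: SerreGaloisCohomology1997, I §2.5 (b)] [cite: Washington1997, §13.1–§13.2] -/
theorem coresShapiro_pow_conjMap_eq_oneCocycleClass_iterate (g : absoluteGaloisGroup K) {a : ℕ}
    (ha : (a : ZMod (p ^ n)) = -κ.layerIndex n g)
    (c : continuousCohomology 1 (subgroupRep ρ.toTopRep (κ.layerSubgroup n)))
    (φ : contOneCocycles (κ.twistModP ρ hM (p ^ n)).toTopRep)
    (hφ : oneCocycleClass _ φ = κ.coresShapiro ρ hM n c) (k : ℕ) :
    κ.coresShapiro ρ hM n (((conjMap ρ.toTopRep (κ.layerSubgroup n) g 1).hom.toLinearMap ^ k) c) =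
      oneCocycleClass _ ((κ.pushCocycle ρ hM (p ^ n) (κ.twistModPUnipotent ρ hM (p ^ n) a))^[k] φ) := by
  induction k with
  | zero =>
    rw [pow_zero, Module.End.one_apply, Function.iterate_zero_apply]
    exact hφ.symm
  | succ k ih =>
    rw [pow_succ', Module.End.mul_apply, Function.iterate_succ_apply', ← map_oneCocycleClass_twist,
      ← ih]
    exact κ.coresShapiro_conjMap ρ hM n g ha _

/-- **`Sh⁻¹ (P(conj_g) c) = [ψ]` with `ψ(x) = P((1+S)^a)(φ(x))`** for `[φ] = Sh⁻¹ c`, `P ∈ ℤ[X]` and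
`a ≡ −κ̄_n(g) (mod pⁿ)`: the polynomial calculus of `H¹`-operators carried out on COCYCLES (where
`H¹(·)` of coefficient maps is additive), so that only values in the module `𝒯_{pⁿ}` are compared.
[cite: SerreGaloisCohomology1997, I §2.2 and §2.5 (b)] -/
theorem exists_cocycle_coresShapiro_aeval_conjMap (g : absoluteGaloisGroup K) {a : ℕ}
    (ha : (a : ZMod (p ^ n)) = -κ.layerIndex n g) (P : ℤ[X])
    (c : continuousCohomology 1 (subgroupRep ρ.toTopRep (κ.layerSubgroup n)))
    (φ : contOneCocycles (κ.twistModP ρ hM (p ^ n)).toTopRep)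
    (hφ : oneCocycleClass _ φ = κ.coresShapiro ρ hM n c) :
    ∃ ψ : contOneCocycles (κ.twistModP ρ hM (p ^ n)).toTopRep,
      (∀ x, ψ.1 x = aeval (unipotentPow M (p ^ n) a) P (φ.1 x)) ∧
      κ.coresShapiro ρ hM n
          (aeval (conjMap ρ.toTopRep (κ.layerSubgroup n) g 1).hom.toLinearMap P c) =
        oneCocycleClass _ ψ := by
  induction P using Polynomial.induction_on' with
  | add P Q hP hQ =>
    obtain ⟨ψ₁, hψ₁, h₁⟩ := hP
    obtain ⟨ψ₂, hψ₂, h₂⟩ := hQ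
    refine ⟨ψ₁ + ψ₂, fun x ↦ ?_, ?_⟩
    · rw [Submodule.coe_add, ContinuousMap.add_apply, hψ₁, hψ₂, aeval_add, LinearMap.add_apply]
    · rw [aeval_add, LinearMap.add_apply, map_add, h₁, h₂, oneCocycleClass_add]
      rfl
  | monomial k b =>
    refine ⟨b • (κ.pushCocycle ρ hM (p ^ n) (κ.twistModPUnipotent ρ hM (p ^ n) a))^[k] φ,
      fun x ↦ ?_, ?_⟩
    · rw [Submodule.coe_smul, ContinuousMap.coe_smul, Pi.smul_apply,
        iterate_pushCocycle_unipotent_apply, aeval_monomial, Module.End.mul_apply,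
        algebraMap_int_eq, Int.coe_castRingHom, Module.End.intCast_apply]
    · rw [aeval_monomial, Module.End.mul_apply, algebraMap_int_eq, Int.coe_castRingHom,
        Module.End.intCast_apply, map_zsmul,
        coresShapiro_pow_conjMap_eq_oneCocycleClass_iterate κ ρ hM n g ha c φ hφ k,
        ← oneCocycleClassₗ_apply, ← oneCocycleClassₗ_apply, map_zsmul]
      rfl

end ShapiroPoly

/-! ## §3 The genuine tame class -/

section TameClass

variable (W : WeierstrassCurve ℚ) [W.IsElliptic] (p : ℕ) [Fact p.Prime]
  [ContinuousSMul ℤ_[p] (W.tateModule p)]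
  [Module.Free ℤ_[p] (W.tateModule p)] [Module.Finite ℤ_[p] (W.tateModule p)]
  (κ : ZpExtension ℚ p) (γ : absoluteGaloisGroup ℚ) (I : IwasawaH1Data W p κ γ)

/-- **THE GENUINE TAME CLASS (input «G3a» of the Kolyvagin cocycle).**  Let `s ∈ 𝐇¹_Γ(T_pW)` be a
genuine Λ-adic Euler-system class (`IsEulerSystemClass`: `s` is the layerwise trace of an INTEGRAL
Euler system `z` for `T_pW` over the cyclotomic levels away from a finite `S`).  Then there is a finite
set `S₀` of places (`S` and the places of `2`, `p`) such that for every place `q ∉ S₀` with prime `ℓ`,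
every layer `n`, every arithmetic Frobenius `Fr` at `q`, every `P̄ ∈ ℤ[X]` lifting
`P(Fr⁻¹ | T_pW*; X) mod p` and every `a ≡ κ̄_n(Fr) (mod pⁿ)`, there is a class
`y ∈ H¹(Gal(ℚ̄/ℚ(μ_ℓ)), 𝒯_{pⁿ})`, `𝒯_{pⁿ} = E[p] ⊗ 𝔽_p[T]/(T^{pⁿ})(χ_κ)` (`= W.modPTwist p κ (pⁿ)`
definitionally), which is (i) INTEGRAL (`Kato2004.integralH1`: vanishing on `N ∩ I_𝔓` for every
`𝔓 ∣ v ≠ p` — the `hyI` of `KolyvaginTwist.exists_kolyvaginCocycle_meetingPoint`), and (ii) satisfies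
the NORM RELATION `cor_N^{Γ_ℚ} y = P̄((1+T)^a) · 𝐳̄₁` in cocycle form: for every cocycle `φ` of
`𝐳̄₁ := (I.redTower s)_{pⁿ}` there is a cocycle `ψ` with VALUES `ψ(g) = P̄((1+S)^a)(φ(g))` and
`cor_N^{Γ_ℚ} y = [ψ]` (so `res (cor y) = Σ σ^i·y` reads on `N` through `ψ` — the norm-witness currency of
`KolyvaginTwist.exists_norm_witness_of_sum_conjMap_eq_resSubgroup`).  This is Kato's
`cor_{ℚ(μ_q)/ℚ} 𝐳̄_q = P_q(Fr_q⁻¹)·𝐳̄₁` (Astérisque 295 (13.1.1), Ex. 13.3) read modulo `(p, T^{pⁿ})`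
through Shapiro's lemma — the INPUT of MU-TRANSFER-PROOF Lemma 2; `y` is
`cor_{N∩Γ_n}^{N}(H¹(m ↦ m T⁰)(red (cor z_{n+1,{q}})))` (relative inverse Shapiro).
[cite: Kato2004Asterisque, (8.1.3), §13.1 (13.1.1), Ex. 13.3 (pp. 224–225) and §13.8 (p. 228)]
[cite: Rubin2000, Def. 2.1.1 and Lemma 4.4.2] [cite: SerreGaloisCohomology1997, I §2.5 Prop. 10 and (b)] -/
theorem exists_tameClass_of_isEulerSystemClass {s : I.H} (hES : IsEulerSystemClass W p κ γ I s) :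
    ∃ S₀ : Set (HeightOneSpectrum (𝓞 ℚ)), S₀.Finite ∧
      ∀ (q : HeightOneSpectrum (𝓞 ℚ)), q ∉ S₀ →
      ∀ (n : ℕ) (Fr : absoluteGaloisGroup ℚ), IsArithFrobAtPlace ℚ q Fr →
      ∀ (Pz : ℤ[X]), Pz.map (Int.castRingHom (ZMod p)) =
          (rubinEulerFactor (tateRep W p).toRepresentation
            (cyclotomicCharacterToUnits ℚ p ℤ_[p]) Fr).map (PadicInt.toZMod (p := p)) →
      ∀ (a : ℕ), (a : ZMod (p ^ n)) = κ.layerIndex n Fr →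
      ∀ [Fintype (absoluteGaloisGroup ℚ ⧸ rootsOfUnityFixer ℚ ((primesEquiv q : Nat.Primes) : ℕ))]
        (hN : IsOpen ((rootsOfUnityFixer ℚ ((primesEquiv q : Nat.Primes) : ℕ) :
          Subgroup (absoluteGaloisGroup ℚ)) : Set (absoluteGaloisGroup ℚ))),
      ∃ y : H1 (κ.twistModP (W.torsionGaloisModule (p : ℤ)) IwasawaH1Data.torsion_nsmul_eq_zero (p ^ n))
          (rootsOfUnityFixer ℚ ((primesEquiv q : Nat.Primes) : ℕ)),
        y ∈ integralH1 (κ.twistModP (W.torsionGaloisModule (p : ℤ))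
          IwasawaH1Data.torsion_nsmul_eq_zero (p ^ n)) p
          (rootsOfUnityFixer ℚ ((primesEquiv q : Nat.Primes) : ℕ)) ∧
        ∀ φ : contOneCocycles (κ.twistModP (W.torsionGaloisModule (p : ℤ))
            IwasawaH1Data.torsion_nsmul_eq_zero (p ^ n)).toTopRep,
          oneCocycleClass _ φ = (I.redTower s : ∀ J : ℕ, galoisCohomology (κ.twistModP
            (W.torsionGaloisModule (p : ℤ)) IwasawaH1Data.torsion_nsmul_eq_zero J) 1) (p ^ n) →
          ∃ ψ : contOneCocycles (κ.twistModP (W.torsionGaloisModule (p : ℤ))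
              IwasawaH1Data.torsion_nsmul_eq_zero (p ^ n)).toTopRep,
            (∀ g, ψ.1 g = aeval (unipotentPow (WeierstrassCurve.geomTorsion W (p : ℤ)) (p ^ n) a) Pz
              (φ.1 g)) ∧
            cores (κ.twistModP (W.torsionGaloisModule (p : ℤ)) IwasawaH1Data.torsion_nsmul_eq_zero
              (p ^ n)).toTopRep (rootsOfUnityFixer ℚ ((primesEquiv q : Nat.Primes) : ℕ)) hN y =
              oneCocycleClass _ ψ := by
  classical
  obtain ⟨S, hSfin, z, hz, hint, h, hproj⟩ := hES
  -- the exceptional set: `S`, and the places of `p` and `2`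
  refine ⟨S ∪ {v | ((primesEquiv v : Nat.Primes) : ℕ) = p ∨ ((primesEquiv v : Nat.Primes) : ℕ) = 2},
    hSfin.union ?_, ?_⟩
  · have hinj : Set.InjOn (fun v : HeightOneSpectrum (𝓞 ℚ) ↦ ((primesEquiv v : Nat.Primes) : ℕ))
        ((fun v : HeightOneSpectrum (𝓞 ℚ) ↦ ((primesEquiv v : Nat.Primes) : ℕ)) ⁻¹' {p, 2}) :=
      fun a _ b _ hab ↦ primesEquiv.injective (Subtype.ext hab)
    exact (Set.toFinite ({p, 2} : Set ℕ)).preimage hinj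
  intro q hq0 n Fr hFr Pz hPz a ha _ hN
  simp only [Set.mem_union, Set.mem_setOf_eq, not_or] at hq0
  obtain ⟨hqS, hqp, hq2⟩ := hq0
  have hq : q ∈ (cyclotomicLevelsRat p S).primes := ⟨hqS, hqp⟩
  haveI : NeZero ((primesEquiv q : Nat.Primes) : ℕ) := ⟨(primesEquiv q).2.ne_zero⟩
  haveI : NeZero (((primesEquiv q : Nat.Primes) : ℕ) : ℚ) :=
    ⟨Nat.cast_ne_zero.mpr (primesEquiv q).2.ne_zero⟩
  haveI hNn : (rootsOfUnityFixer ℚ ((primesEquiv q : Nat.Primes) : ℕ)).Normal :=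
    Subgroup.Normal.of_commutator_le _ (commutator_le_rootsOfUnityFixer ℚ _)
  -- the subgroups `V = Gal(ℚ̄/ℚ(μ_{p^{n+1}}, μ_ℓ)) ≤ U = N ∩ Γ_n ≤ Γ_n`, `U ≤ N`
  have hUo : IsOpen ((rootsOfUnityFixer ℚ ((primesEquiv q : Nat.Primes) : ℕ) ⊓ κ.layerSubgroup n :
      Subgroup (absoluteGaloisGroup ℚ)) : Set (absoluteGaloisGroup ℚ)) :=
    isOpen_inf_layerSubgroup κ n _ hN
  have hle : (cyclotomicLevelsRat p S).level (n + 1) ((cyclotomicLevelsRat p S).idealOne.cons q hq).1 ≤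
      (cyclotomicLevelsRat p S).level (n + 1) ∅ :=
    (cyclotomicLevelsRat p S).level_insert_le (n + 1) (cyclotomicLevelsRat p S).idealOne.1 q
  have hVU : (cyclotomicLevelsRat p S).level (n + 1) ((cyclotomicLevelsRat p S).idealOne.cons q hq).1 ≤
      rootsOfUnityFixer ℚ ((primesEquiv q : Nat.Primes) : ℕ) ⊓ κ.layerSubgroup n := by
    intro g hg
    refine ⟨?_, h n (hle hg)⟩
    rw [EulerSystemLevels.mem_level_iff] at hg
    exact hg.2 q (Finset.mem_insert_self q _)
  -- finiteness instances (all `Fintype.ofFinite`, matching `coresToLayer` / `coresCons`)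
  haveI : (rootsOfUnityFixer ℚ ((primesEquiv q : Nat.Primes) : ℕ) ⊓ κ.layerSubgroup n).FiniteIndex :=
    finiteIndex_of_isOpen_of_compactSpace _ hUo
  letI : Fintype (absoluteGaloisGroup ℚ ⧸ κ.layerSubgroup n) := κ.fintypeQuotientLayer n
  letI : Fintype (absoluteGaloisGroup ℚ ⧸
      (rootsOfUnityFixer ℚ ((primesEquiv q : Nat.Primes) : ℕ) ⊓ κ.layerSubgroup n)) :=
    Fintype.ofFinite _
  letI : Fintype (↥(rootsOfUnityFixer ℚ ((primesEquiv q : Nat.Primes) : ℕ)) ⧸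
      (rootsOfUnityFixer ℚ ((primesEquiv q : Nat.Primes) : ℕ) ⊓ κ.layerSubgroup n).subgroupOf
        (rootsOfUnityFixer ℚ ((primesEquiv q : Nat.Primes) : ℕ))) :=
    Fintype.ofFinite _
  letI : Fintype (↥(κ.layerSubgroup n) ⧸
      (rootsOfUnityFixer ℚ ((primesEquiv q : Nat.Primes) : ℕ) ⊓ κ.layerSubgroup n).subgroupOf
        (κ.layerSubgroup n)) :=
    Fintype.ofFinite _
  letI : Fintype (↥(κ.layerSubgroup n) ⧸
      ((cyclotomicLevelsRat p S).level (n + 1) ∅).subgroupOf (κ.layerSubgroup n)) :=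
    Fintype.ofFinite _
  letI : Fintype (↥(rootsOfUnityFixer ℚ ((primesEquiv q : Nat.Primes) : ℕ) ⊓ κ.layerSubgroup n) ⧸
      ((cyclotomicLevelsRat p S).level (n + 1) ((cyclotomicLevelsRat p S).idealOne.cons q hq).1).subgroupOf
        (rootsOfUnityFixer ℚ ((primesEquiv q : Nat.Primes) : ℕ) ⊓ κ.layerSubgroup n)) :=
    Fintype.ofFinite _
  -- the tame class at the layer `ℚ_n(μ_ℓ)` with `T_pW`-coefficients: integral, and so is its reduction
  have hyT : coresLe (tateRep W p).toTopRep hVU ((cyclotomicLevelsRat p S).isOpen_level (n + 1) _)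
      (z (n + 1) ((cyclotomicLevelsRat p S).idealOne.cons q hq)) ∈
      integralH1 (tateRep W p) p
        (rootsOfUnityFixer ℚ ((primesEquiv q : Nat.Primes) : ℕ) ⊓ κ.layerSubgroup n) :=
    coresLe_cons_mem_integralH1 W p hint (n + 1) hq hVU
  have hred := reduceH1_mem_integralH1 W p _ hyT
  -- the norm relation at the layer, modulo `p`
  have hnorm : coresLe (W.torsionGaloisModule (p : ℤ)).toTopRep
        (inf_le_right : rootsOfUnityFixer ℚ ((primesEquiv q : Nat.Primes) : ℕ) ⊓ κ.layerSubgroup n ≤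
          κ.layerSubgroup n) hUo
        (reduceH1 W p _ (coresLe (tateRep W p).toTopRep hVU
          ((cyclotomicLevelsRat p S).isOpen_level (n + 1) _)
          (z (n + 1) ((cyclotomicLevelsRat p S).idealOne.cons q hq)))) =
      aeval (conjMap (W.torsionGaloisModule (p : ℤ)).toTopRep (κ.layerSubgroup n) Fr⁻¹ 1).hom.toLinearMap
        Pz (I.red s n) := by
    rw [I.red_apply, hproj n]
    exact coresLe_reduceH1_coresLe_cons_eq_aeval W p hz (n + 1) hq hq2 hFr Pz hPz hUo (h n)
      (inf_le_right : rootsOfUnityFixer ℚ ((primesEquiv q : Nat.Primes) : ℕ) ⊓ κ.layerSubgroup n ≤ _)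
      hVU
  have ha' : (a : ZMod (p ^ n)) = -κ.layerIndex n Fr⁻¹ := by rw [κ.layerIndex_inv, neg_neg, ha]
  -- the class `y` (relative inverse Shapiro of the reduced layer class)
  refine ⟨coresLe (κ.twistModP (W.torsionGaloisModule (p : ℤ)) IwasawaH1Data.torsion_nsmul_eq_zero
        (p ^ n)).toTopRep
      (inf_le_left : rootsOfUnityFixer ℚ ((primesEquiv q : Nat.Primes) : ℕ) ⊓ κ.layerSubgroup n ≤
        rootsOfUnityFixer ℚ ((primesEquiv q : Nat.Primes) : ℕ)) hUo
      (cohomologyMap (restrictHomOfLe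
        (inf_le_right : rootsOfUnityFixer ℚ ((primesEquiv q : Nat.Primes) : ℕ) ⊓ κ.layerSubgroup n ≤
          κ.layerSubgroup n)
        (κ.unitCoeffHom (W.torsionGaloisModule (p : ℤ)) IwasawaH1Data.torsion_nsmul_eq_zero n)) 1
        (reduceH1 W p _ (coresLe (tateRep W p).toTopRep hVU
          ((cyclotomicLevelsRat p S).isOpen_level (n + 1) _)
          (z (n + 1) ((cyclotomicLevelsRat p S).idealOne.cons q hq))))), ?_, ?_⟩
  · -- (i) integrality
    refine coresLe_mem_integralH1_inf _ p hUo (fun v hv 𝔓 h𝔓 ↦ ?_)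
      (cohomologyMap_mem_integralH1 (W.torsionGaloisModule (p : ℤ)) _ p _ hred)
    exact CoresUnramified.subgroupIsUnramifiedAt_layerSubgroup κ
      (WeierstrassCurve.natCast_not_mem_asIdeal_of_primesEquiv_ne Fact.out hv) n 𝔓 h𝔓
  · -- (ii) the norm relation, in cocycle form
    intro φ hφ
    have hφ' : oneCocycleClass _ φ = κ.coresShapiro (W.torsionGaloisModule (p : ℤ))
        IwasawaH1Data.torsion_nsmul_eq_zero n (I.red s n) := by
      rw [hφ, I.redTower_apply_coe_pow s n, I.red_apply]
    obtain ⟨ψ, hψ, hclass⟩ := exists_cocycle_coresShapiro_aeval_conjMap κ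
      (W.torsionGaloisModule (p : ℤ)) IwasawaH1Data.torsion_nsmul_eq_zero n Fr⁻¹ ha' Pz (I.red s n) φ hφ'
    refine ⟨ψ, hψ, ?_⟩
    rw [cores_coresLe_cohomologyMap_unitCoeff κ (W.torsionGaloisModule (p : ℤ))
      IwasawaH1Data.torsion_nsmul_eq_zero n _ hN hUo, hnorm]
    exact hclass

end TameClass

end Summit.BirchSwinnertonDyer.BirchSwinnertonDyer.Rank1Residual.TameClass

end
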